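import Summits.Ventures.PercRepro.RankLevelSetRuleQSixteenPitCore
import Summits.Ventures.PercRepro.RankLevelSetRuleQConvTwentySeven
import Summits.Ventures.PercRepro.RankLevelSetRuleQConvTwentyNine
import Summits.Ventures.PercRepro.KroneckerPIT


/-!
# PercRepro — THE HORNER DEFINITIONS OF THE FAMILY `k = 16` AS EXPRESSION TREES (p4, gen 27; C-044; paper
proofs/P4-CELL-THREE.md §13.9)

The Horner definitions `naSixteen`, `nbSixteen` (RankLevelSetRuleQSixteenCoreDefs1) and, where the tree holds a convergent in Horner form,
`cfN`/`cfD`, transcribed as `PercRepro.PIT.PExpr` trees with the link lemmas `*_evalE` (`unfold`, `simp only [evalE]`,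
`push_cast`, `rfl`: the same nested expression), so that the sign certificates of RankLevelSetRuleQSixteenPitCert can be checked
by one Kronecker evaluation.  No `sorry`; axioms standard.
-/

namespace PercRepro

open PIT

/-- `naSixteen` is the evaluation of its expression tree (by definition). -/
lemma naSixteen_evalE (q m : ℚ) : naSixteen q m = evalE q m sixteenNaE := rfl

/-- `nbSixteen` is the evaluation of its expression tree (by definition). -/
lemma nbSixteen_evalE (q m : ℚ) : nbSixteen q m = evalE q m sixteenNbE := rfl

end PercRepro
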